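import Mathlib
import Summits.ResolutionOfSingularities.ResolutionOfSingularities.Theorems.WeightedInvariantLocalWeightedDropMultiplicityLift

/-!
# `WeightedInvariant.LocalWeightedDrop`, residual T″|₄ `stub_tameWideApexFourStartsWon` (skeleton v31): the RELATIVE tame-multiplicity lift —
# `StepDrop κ P` on a successor-closed CLASS `P` of bad tuples suffices to win the prepared germs of the class

Crux item stmt-ResolutionOfSingularities-8899 `LocalWeightedDrop` (route `ResolutionOfSingularities/WeightedInvariant`), engine skeleton v31
(fb48e93459d3708f), residual T″|₄ `stub_tameWideApexFourStartsWon`.  [OURS · L1 W4.3, chain w43, res-L1-w43-stub-1 (gen 4) on plan-1's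
DEALS gen 9 #26 «N = 4 TAME census + first cut», option (K-b) of `L/res-L1-w43-stub-1/N4-TAME-CENSUS.md` v1.1 / `KB-DESIGN.md` file F-B.
The proof is a TRANSPLANT of the landed `stub_multiplicityLift` (`…MultiplicityLift`, all dimensions, maximal contact for a multiplicity
invertible in `k`) with the global tuple game `TupleGame.Drop k m e` (`∃ κ, ∀ a, StepDrop κ ⊤ a`) replaced by a rank `κ` and a predicate `P`
with `StepDrop κ P` only ON the class `P` (which `StepDrop κ P` itself propagates to the bad successors); every algebraic lemma is the
landed file's (`MultiplicityLift.*`, `…MultiplicityLiftAux`).  Nothing here is a statement of any manuscript; the games are OURS.]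

`TameN4.multiplicityLift_rel`: if `((e+2 : ℕ) : k) ≠ 0`, `κ`/`P` satisfy «every non-zero bad tuple in `P` has a move after which, at every
exceptional point, some live slot carries a successor tuple that is zero, or not bad, or again in `P` with smaller `κ`» (`StepDrop κ P`), and
every singular germ of order `< e + 2` in `m + 1` variables is won, then every prepared germ `U · y^{e+2} + Σ a_j y^j` (`U(0) ≠ 0`) of a
non-zero bad tuple `a ∈ P` is won.  With `P := ⊤` this is `stub_multiplicityLift` verbatim; the point of the relative form is that a
PER-CLASS order reduction of the coefficient tuples (e.g. «support product finitely NC-winnable», file F-A/F-C) lifts to N = m + 1 wins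
without the global `Drop`.  AI-written; gate-accepted means sorry-free with standard axioms, not refereed.
-/

set_option linter.dupNamespace false -- mandated namespace of this single-conjunct summit

namespace Summit.ResolutionOfSingularities.ResolutionOfSingularities.Theorems

open Literature.AlgebraicGeometry.Resolution
open Literature.AlgebraicGeometry.Resolution.CobordantGame

namespace TameN4

open MultiplicityLift MvPowerSeries in
/-- **THE RELATIVE MULTIPLICITY LIFT** (all dimensions; `P`-relative form of `stub_multiplicityLift`): a rank `κ` with `StepDrop κ P` on the
non-zero bad tuples of a class `P`, together with the wins of all singular germs of smaller order, wins the prepared germ `U·y^{e+2} + Σ a_j y^j`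
of every non-zero bad tuple of the class (induction on `κ a`; the class is carried along by `StepDrop`). -/
theorem multiplicityLift_rel : ∀ (p : ℕ), p.Prime → ∀ (k : Type) [Field k] [CharP k p]
    (m e : ℕ), ((e + 2 : ℕ) : k) ≠ 0 →
    ∀ (κ : (Fin (e + 1) → MvPowerSeries (Fin m) k) → Ordinal.{0}) (P : (Fin (e + 1) → MvPowerSeries (Fin m) k) → Prop),
    (∀ a : Fin (e + 1) → MvPowerSeries (Fin m) k, a ≠ 0 → TupleGame.Bad a → P a → TupleGame.StepDrop κ P a) →
    (∀ G : MvPowerSeries (Fin (m + 1)) k, CobordantGame.IsSingular k G → G.order < ((e + 2 : ℕ) : ℕ∞) →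
      CobordantGame.Won k (m + 1) G) →
    ∀ (U : MvPowerSeries (Fin (m + 1)) k) (a : Fin (e + 1) → MvPowerSeries (Fin m) k),
      MvPowerSeries.constantCoeff U ≠ 0 → a ≠ 0 → TupleGame.Bad a → P a →
      CobordantGame.Won k (m + 1) (TupleGame.germ U a) := by
  intro p hp k _ _ m e he κ P hκ hord
  suffices key : ∀ (α : Ordinal.{0}) (a : Fin (e + 1) → MvPowerSeries (Fin m) k), κ a = α → a ≠ 0 →
      TupleGame.Bad a → P a → ∀ U : MvPowerSeries (Fin (m + 1)) k, constantCoeff U ≠ 0 →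
      Won k (m + 1) (TupleGame.germ U a) from fun U a hU ha hBad hPa => key _ a rfl ha hBad hPa U hU
  intro α
  induction α using WellFoundedLT.induction with
  | ind α ih =>
  intro a hα ha hBad hPa U hU
  obtain ⟨Φ, w, hΦ0, hdet, hw1, ⟨i₁, hi₁⟩, hdrop⟩ := hκ a ha hBad hPa
  have hΦs : HasSubst Φ := hasSubst_of_constantCoeff_zero hΦ0
  have hBne : ∀ j, a j ≠ 0 → subst Φ (a j) ≠ 0 := fun j hj =>
    FormalCoordChange.subst_ne_zero_of_isUnit_det hΦ0 hdet hj
  have haj0 : ∀ j, constantCoeff (a j) = 0 := fun j => by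
    rcases hBad j with h | h
    · rw [h, map_zero]
    · rw [← coeff_zero_eq_constantCoeff_apply]
      apply coeff_of_lt_order
      refine lt_of_lt_of_le ?_ h
      rw [map_zero]
      exact_mod_cast TupleGame.marking_pos e j
  -- the `w`-orders `D_j` of the moved entries, the floor weight `W`, the mirrored move `(Θ, Wt)`
  obtain ⟨D, hD⟩ : ∃ D : Fin (e + 1) → ℕ, ∀ j, a j ≠ 0 → ((D j : ℕ) : ℕ∞) = (subst Φ (a j)).weightedOrder w :=
    ⟨fun j => ((subst Φ (a j)).weightedOrder w).toNat, fun j hj =>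
      (ne_zero_iff_weightedOrder_finite w).mp (hBne j hj)⟩
  obtain ⟨W, hW⟩ : ∃ W : ℕ, W = TupleGame.floorWeight a D := ⟨_, rfl⟩
  obtain ⟨Θ, hΘ⟩ : ∃ Θ : Fin (m + 1) → MvPowerSeries (Fin (m + 1)) k,
      Θ = Fin.insertNth (α := fun _ => MvPowerSeries (Fin (m + 1)) k) (Fin.last m) (X (Fin.last m))
        (fun i => rename (Fin.succAboveEmb (Fin.last m)) (Φ i)) := ⟨_, rfl⟩
  obtain ⟨Wt, hWt⟩ : ∃ Wt : Fin (m + 1) → ℕ, Wt = Fin.insertNth (α := fun _ => ℕ) (Fin.last m) W w := ⟨_, rfl⟩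
  have hΘ0 : ∀ i, constantCoeff (Θ i) = 0 := hΘ ▸ constantCoeff_cylMove (Fin.last m) Φ hΦ0
  refine Won.move Θ Wt ⟨hΘ0, by rw [hΘ, det_linMat_cylMove]; exact hdet, (Fin.last m).succAbove i₁,
    by rw [hWt, Fin.insertNth_apply_succAbove]; exact hi₁⟩ ?_
  rintro g ⟨pt, A, hoff, hfac, hndvd, hsing⟩
  -- the projected exceptional point (with the convention) and the factorisations `a_j ∘ Φ (chart) = s^{D_j} G_j`
  obtain ⟨c', hc'⟩ : ∃ c' : Fin m → k, c' = fun i => pt ((Fin.last m).succAbove i) := ⟨_, rfl⟩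
  obtain ⟨c'', hc''⟩ : ∃ c'' : Fin m → k, ∀ i, c'' i = if 0 < w i then c' i else 0 := ⟨_, fun _ => rfl⟩
  have hconv : ∀ i, w i = 0 → c'' i = 0 := fun i hi => by rw [hc'', hi, if_neg (lt_irrefl 0)]
  have hcc : cruxChart k w c' = CobordantChart.chart w c'' := by
    rw [show c'' = fun i => if 0 < w i then c' i else 0 from funext hc'']
    exact CobordantChart.cruxChart_eq_chart w c'
  have hGex : ∀ j, ∃ Gj : MvPowerSeries (Fin (m + 1)) k,
      subst (CobordantChart.chart w c'') (subst Φ (a j)) = X 0 ^ D j * Gj ∧ (a j ≠ 0 → ¬ X 0 ∣ Gj) ∧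
        (a j = 0 → Gj = 0) := by
    intro j
    by_cases hj : a j = 0
    · refine ⟨0, ?_, fun h => absurd hj h, fun _ => rfl⟩
      rw [hj, ← coe_substAlgHom hΦs, map_zero, ← coe_substAlgHom (CobordantChart.hasSubst_chart w c'' hconv),
        map_zero, mul_zero]
    · obtain ⟨d, Gj, hfacj, hGj⟩ :=
        exists_eq_X_pow_mul_not_dvd 0 (CobordantChart.subst_chart_ne_zero w c'' hconv (hBne j hj))
      have hd := CobordantChart.eq_weightedOrder_of_factor w c'' hconv (hBne j hj) hfacj hGj
      rw [← hD j hj, Nat.cast_inj] at hd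
      subst hd
      exact ⟨Gj, hfacj, fun _ => hGj, fun h => absurd h hj⟩
  choose G hGfac hGndvd hG0 using hGex
  have hGD : ∀ j, rename (Fin.succAboveEmb (Fin.last (m + 1))) (G j) = 0 ∨ TupleGame.marking e j * W ≤ D j := by
    intro j
    by_cases hj : a j = 0
    · left
      rw [hG0 j hj, map_zero]
    · right
      rw [hW]
      exact TupleGame.marking_mul_floorWeight_le D hj
  -- THE TRANSFORM `s^{(e+2)W} · g₀`; `s ∤ g₀`, so `g₀` is the successor `g`
  obtain ⟨γ, hγ⟩ : ∃ γ : k, γ = if 0 < W then pt (Fin.last m) else 0 := ⟨_, rfl⟩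
  obtain ⟨V, hV⟩ : ∃ V : MvPowerSeries (Fin (m + 1 + 1)) k, V = subst (cruxChart k Wt pt) (subst Θ U) := ⟨_, rfl⟩
  have hV0 : constantCoeff V = constantCoeff U := by
    rw [hV, constantCoeff_subst_of_constantCoeff_zero _ (constantCoeff_cruxChart Wt pt),
      constantCoeff_subst_of_constantCoeff_zero _ hΘ0]
  obtain ⟨g₀, hg₀⟩ : ∃ g₀ : MvPowerSeries (Fin (m + 1 + 1)) k, g₀ = V * (C γ + X (Fin.last (m + 1))) ^ (e + 2) +
      ∑ j, X 0 ^ (D j - TupleGame.marking e j * W) * rename (Fin.succAboveEmb (Fin.last (m + 1))) (G j) *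
        (C γ + X (Fin.last (m + 1))) ^ (j : ℕ) := ⟨_, rfl⟩
  have hT : subst (cruxChart k Wt pt) (subst Θ (TupleGame.germ U a)) = X 0 ^ ((e + 2) * W) * g₀ := by
    rw [transform_germ hΘ hWt hΦ0 pt U a, ← hc', hcc, hg₀, ← hγ, ← hV]
    simp only [hGfac, map_mul, map_pow, rename_X,
      show (Fin.succAboveEmb (Fin.last (m + 1))) (0 : Fin (m + 1)) = 0 from succAboveEmb_succ_zero (Fin.last m)]
    exact transform_factor (X 0) V _ (fun j => X 0 ^ D j * rename (Fin.succAboveEmb (Fin.last (m + 1))) (G j))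
      (fun j => rename (Fin.succAboveEmb (Fin.last (m + 1))) (G j)) D (fun _ => rfl) hGD
  have hfac₀ := hfac
  rw [hT] at hfac
  obtain ⟨π, hπ⟩ : ∃ π : Fin (m + 1 + 1) → MvPowerSeries (Fin (m + 1 + 1)) k,
      ∀ l, π l = if l = Fin.last (m + 1) then X l else 0 := ⟨_, fun _ => rfl⟩
  have hVπ : 0 < W → subst π V = C (constantCoeff U) := fun hWpos => by
    rw [hV, subst_proj_subst_cruxChart hπ hWt hWpos, constantCoeff_subst_of_constantCoeff_zero _ hΘ0]
  have htop : coeff (Finsupp.single (Fin.last (m + 1)) (e + 2)) g₀ = constantCoeff U := by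
    by_cases hWpos : 0 < W
    · rw [hg₀]
      exact coeff_top_g₀ hπ (hVπ hWpos) γ G _
    · rw [hg₀, show γ = 0 by rw [hγ, if_neg hWpos], coeff_single_g₀_zero, hV0]
  have hndvd₀ : ¬ X 0 ∣ g₀ := fun h => hU (by
    rw [← htop]
    exact X_dvd_iff.mp h _ (by rw [Finsupp.single_apply, if_neg Fin.last_pos.ne']))
  obtain ⟨-, hgg⟩ := X_pow_mul_eq_X_pow_mul 0 hfac hndvd₀ hndvd
  subst hgg
  -- AN OLD SLOT IS LIVE (`c'' ≠ 0`): otherwise `γ = pt_y ≠ 0`, `W > 0`, all `G_j(0) = 0` and `g₀(0) = U(0) γ^{e+2} ≠ 0`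
  have hc''ne : c'' ≠ 0 := by
    intro h0
    obtain ⟨l, hWl, hCl⟩ := hoff
    rcases Fin.eq_self_or_eq_succAbove (Fin.last m) l with rfl | ⟨i, rfl⟩
    · rw [hWt, Fin.insertNth_apply_same] at hWl
      have hGc : ∀ j, constantCoeff (G j) = 0 := by
        intro j
        by_cases hj : a j = 0
        · rw [hG0 j hj, map_zero]
        · have hf := hGfac j
          rw [h0] at hf
          exact constantCoeff_eq_zero_of_factor_vertex w (constantCoeff_subst_eq_zero hΦs hΦ0 (haj0 j)) hf
      have h00 := hsing.1
      rw [hg₀, constantCoeff_g₀ hπ (hVπ hWl) γ hGc, hγ, if_pos hWl] at h00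
      exact (mul_ne_zero hU (pow_ne_zero _ hCl)) h00
    · rw [hWt, Fin.insertNth_apply_succAbove] at hWl
      apply hCl
      have h := congrFun h0 i
      rw [hc'', if_pos hWl, hc'] at h
      exact h
  -- THE SLOT `i₀` NAMED BY THE TUPLE GAME (`c''_{i₀} ≠ 0`, so `w_{i₀} = 1`: tame) and THE TAME SLICE there
  obtain ⟨i₀, hci₀, himp⟩ := hdrop c'' hconv hc''ne D G (fun j hj => ⟨hGfac j, hGndvd j hj⟩)
  have hwi₀ : 0 < w i₀ := Nat.pos_of_ne_zero fun h => hci₀ (hconv i₀ h)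
  have hpti₀ : pt (Fin.castSucc i₀) ≠ 0 := by
    have h := hci₀
    rw [hc'', if_pos hwi₀, hc', Fin.succAbove_last] at h
    exact h
  obtain ⟨Cb, hCb⟩ : ∃ Cb : Fin (m + 1) → k, ∀ l, Cb l = if 0 < Wt l then pt l else 0 := ⟨_, fun _ => rfl⟩
  have hconvb : ∀ l, Wt l = 0 → Cb l = 0 := fun l hl => by rw [hCb, hl, if_neg (lt_irrefl 0)]
  have hccb : cruxChart k Wt pt = CobordantChart.chart Wt Cb := by
    rw [show Cb = fun l => if 0 < Wt l then pt l else 0 from funext hCb]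
    exact CobordantChart.cruxChart_eq_chart Wt pt
  have hWts : Wt (Fin.castSucc i₀) = 1 := by
    rw [hWt, ← Fin.succAbove_last_apply, Fin.insertNth_apply_succAbove]
    exact le_antisymm (hw1 i₀) hwi₀
  have hCbs : Cb (Fin.castSucc i₀) ≠ 0 := by
    rw [hCb, hWts, if_pos one_pos]
    exact hpti₀
  rw [hccb] at hfac₀
  obtain ⟨Φ₂, u, hΦ₂0, hΦ₂det, hu, hgeq⟩ := tameSlice p hp k (m + 1) (subst Θ (TupleGame.germ U a)) Wt Cb hconvb
    A g₀ hfac₀ (Fin.castSucc i₀) hCbs (by rw [hWts]; exact hp.not_dvd_one)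
  set S : MvPowerSeries (Fin (m + 1)) k := subst (fun j : Fin (m + 1 + 1) => if j = (Fin.castSucc i₀).succ
    then (0 : MvPowerSeries (Fin (m + 1)) k) else X (Fin.predAbove (Fin.castSucc i₀) j)) g₀ with hS
  suffices hWS : Won k (m + 1) S by
    rw [hgeq]
    exact (won_unit_mul_iff hu _).mpr ((won_subst_iff hΦ₂0 hΦ₂det _).mpr (won_cyl (Fin.castSucc i₀).succ hWS))
  by_cases hSs : IsSingular k S
  swap
  · exact (wonBy_zero_of_not_isSingular m.succ_pos hSs).won
  by_cases hγ0 : γ = 0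
  · -- `γ = 0`: THE SHAPE REPRODUCES, `S = germ Ũ ã`, `ã = newTuple a D G i₀`, `Ũ` the sliced unit
    have hslice0 : ∀ j : Fin (m + 1 + 1), constantCoeff ((fun j : Fin (m + 1 + 1) => if j = (Fin.castSucc i₀).succ
        then (0 : MvPowerSeries (Fin (m + 1)) k) else X (Fin.predAbove (Fin.castSucc i₀) j)) j) = 0 := fun j => by
      dsimp only
      split_ifs <;> simp [constantCoeff_X]
    set Ut : MvPowerSeries (Fin (m + 1)) k := subst (fun j : Fin (m + 1 + 1) => if j = (Fin.castSucc i₀).succ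
      then (0 : MvPowerSeries (Fin (m + 1)) k) else X (Fin.predAbove (Fin.castSucc i₀) j)) V with hUt
    have hVs : constantCoeff Ut ≠ 0 := by
      rw [hUt, constantCoeff_subst_of_constantCoeff_zero _ hslice0, hV0]
      exact hU
    have hnt : TupleGame.newTuple a D G i₀ =
        fun j => TupleGame.slice i₀ (X 0 ^ (D j - TupleGame.marking e j * W) * G j) := by
      funext j
      unfold TupleGame.newTuple
      rw [← hW]
      split_ifs with hj
      · rw [hG0 j hj, mul_zero]
        unfold TupleGame.slice
        rw [← coe_substAlgHom (CobordantChartPlaneSlice.hasSubst_slice i₀), map_zero]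
      · rfl
    have hSgerm : S = TupleGame.germ Ut (TupleGame.newTuple a D G i₀) := by
      rw [hS, hg₀, hγ0, hnt, hUt]
      exact slice_shape i₀ V G _
    rw [hSgerm] at hSs ⊢
    by_cases hã : TupleGame.newTuple a D G i₀ = 0
    · -- zero successor tuple: a unit times `y^{e+2}`
      rw [hã] at hSs ⊢
      have hpure : TupleGame.germ Ut (0 : Fin (e + 1) → MvPowerSeries (Fin m) k) = Ut * X (Fin.last m) ^ (e + 2) := by
        unfold TupleGame.germ
        simp
      rw [hpure]
      exact (stub_purePowerWon k m Ut (X (Fin.last m)) (e + 2) hVs (constantCoeff_X _)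
        ⟨Fin.last m, by rw [coeff_X, if_pos rfl]; exact one_ne_zero⟩).won
    by_cases hSo : (TupleGame.germ Ut (TupleGame.newTuple a D G i₀)).order < ((e + 2 : ℕ) : ℕ∞)
    · exact hord _ hSs hSo
    -- a non-zero BAD successor tuple of smaller rank: induction
    have hBadã : TupleGame.Bad (TupleGame.newTuple a D G i₀) := by
      intro j
      by_contra hcon
      push Not at hcon
      exact hSo (germ_order_lt _ _ hcon.2)
    obtain ⟨hPnew, hlt⟩ := himp hã hBadã
    exact ih _ (hα ▸ hlt) _ rfl hã hBadã hPnew _ hVs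
  · -- `γ ≠ 0` (so `W > 0`): the monomial `(e+2) γ U(0) · Y^{e+1}` of `g₀` survives in `S`, `ord S ≤ e + 1`
    have hWpos : 0 < W := by
      by_contra h
      exact hγ0 (by rw [hγ, if_neg h])
    have hSc : coeff (Finsupp.single (Fin.last m) (e + 1)) S ≠ 0 := by
      rw [hS, coeff_single_last_slice, hg₀, coeff_sub_g₀ hπ (hVπ hWpos) γ G _]
      exact mul_ne_zero (mul_ne_zero hU he) hγ0
    refine hord S hSs (lt_of_le_of_lt (order_le hSc) ?_)
    rw [Finsupp.degree_single]
    exact_mod_cast Nat.lt_succ_self (e + 1)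


end TameN4

end Summit.ResolutionOfSingularities.ResolutionOfSingularities.Theorems
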